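/-
Copyright (c) 2026 the pub-hodgecm-mathlib formalisation cell (harness21).  Prover seat hodgecm-mathlib-LH4-p01 (g17): STAGE 1a «(D-RAM) FOUR-FRAME» crux H413; dealer LH4-plan (g10)
WORD #18 (deal), U2G assembler B-p08 (g41) «YOURS» 21:13:57Z — TIER 2 for `stub_U2G_dict_edge` of `Cruxes/H413/Lines/F0_P3c_DyRamFourFrame_U2G_Census.lean`.  2026-09-03.
-/
import Summits.HodgeConjecture.HodgeConjecture.Theorems.F0P3cDyRamPieceCountDictionaryProfiles  -- ★ p854797 (B-p08): brings CensusDefs (`PieceCountDictionary`, `cntEdge`, `fixedEdgeCount`), ★ p854742 `coe_mem_unitaryGroupOfForm_over`, ★ p854635 (eigenframe), ★ p854688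
import Summits.HodgeConjecture.HodgeConjecture.Theorems.F0P3cDyRamWildPlaceDatum                -- ★ p854601 (LH4-p02): `exists_isRamifiedQuadraticDatum_of_placesOver` (the wild datum at the CM place)
import Literature.NumberTheory.Automorphic.OrbitalIntegralFixedPointWeightedAction              -- ★ `classOrbitalIntegral_eq_smul_finsum_fixedPoints_of_vertexAction` (the weighted fixed-vertex reading)
import Literature.NumberTheory.Automorphic.UnitaryLatticeTreeRootStarCountWild                 -- ★ p854714 (LH4-p02): `mem_neighborSet_root_iff_exists_mem_unitaryInt_of_even` (wild root star = `K₀·N₁`)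
import Literature.NumberTheory.Automorphic.UnitaryLatticeTreeFixedStar                         -- ★ `mapGL_mul_N₁_eq_of_congr_one` (`γ ≡ 1 (ϖ)` fixes `κ·N₁`)
import Literature.NumberTheory.Automorphic.UnitaryLevelTwoLiftPieces                           -- ★ `isLocSmooth_of_level_invariant_of_support_subset`, `mem_cmLocalIntegralLevel_of_level`
import Literature.NumberTheory.Automorphic.UnitaryLevelTwoInteriorRelabel                      -- ★ `mem_cmLocalIntegralLevel_iff_isIntMatrix`
import Literature.NumberTheory.Automorphic.HyperspecialUnitaryCartan                           -- ★ `map_toLin'_one` (`latt 1 = 𝒪³`)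
import HarnessLib

/-!
# Crux `H413`, line LH4 «(D-RAM) FOUR-FRAME», STAGE 1a — TIER 2 FOR U2G: THE CENSUS DICTIONARY OF THE EDGE PIECE `g_E`
# `PieceCountDictionary pieceEdge cntEdge` — `Φ(⟦γ⟧, g_E; mG₃) = νG₃(K) · fixedEdgeCount σ_w ϖ (ι_w γ)` on the type-(1) population

Cell `hodgecm-mathlib` (D-0151), FLOOR 0, crux item H413 = `stmt-HodgeConjecture-24833`; `--supports … --as helper` (count-neutral).  THEOREMS ONLY.  Pays the registered stub
`U2GCensus.stub_U2G_dict_edge` BY NAME (`:= pieceCountDictionary_edge`).  `K = Stab_U(𝒪_w³)`, `g_E(u) = 1_K(u)·#{N : type 2, N ≤ 𝒪³, ι_w(u)·N = N}` (★ №3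
`pieceEdge` ∕ `edgeFixCount`), `fixedEdgeCount T = #{(M, N) : M type 0, N type 2, N ≤ M, T·M = M, T·N = N}` (★ CensusDefs).  For a type-(1) literal `γ`:
§1 LATTICE SIDE (any valued field): `edgeFixCount (x⁻¹ T x) = #{N : type 2, N ≤ x·𝒪³, T·N = N}` (transport by `mapGL x`), `Ad K`-invariance, and at a WILD RAMIFIED
DATUM `edgeFixCount (U T) = edgeFixCount T` for `U ≡ 1 (mod ϖ)`, `T ∈ K₀` (every type-2 `N ≤ 𝒪³` is `κ·N₁`, ★ p854714 over ★ p854659; `U` fixes `κ·N₁`, ★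
`mapGL_mul_N₁_eq_of_congr_one`) — so `g_E` is left-`K(ϖ)`-invariant, hence locally smooth (★ `isLocSmooth_of_level_invariant_of_support_subset`).  §2 THE FIBRE COUNT
`Σ_{M type 0, T·M = M} #{N : type 2, N ≤ M, T·N = N} = fixedEdgeCount T`.  §3–§4: ★ `classOrbitalIntegral_eq_smul_finsum_fixedPoints_of_vertexAction` on the type-0 vertex
set (`act u M = ι_w(u)·M`, `x₀ = 𝒪_w³`, `Kv = K`, transitivity ★ p854598, value law §1) gives `Φ(⟦γ⟧, g_E) = ν(K)·Σ_{M ∈ Fix(γ)} #{N : type 2, N ≤ M, γ·N = N}`; §2 closes.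
Frame ADAPTED from ★ p854797 (B-p08 (g41)).  HONEST LABEL: count-neutral helper; h413 OPEN; HC_CM is proved only modulo the 7 printed citations (2 remaining named inputs
hLiu418 = stmt-HodgeConjecture-24832, h413 = stmt-HodgeConjecture-24833) until rung 0 closes.  Nothing printed is asserted.

## References
* [Kottwitz1986BaseChangeUnits] R. E. Kottwitz, *Base change for unit elements of Hecke algebras*, Compositio Math. 60 (1986), §3 (fixed points on the building).
* [Rogawski1990] J. D. Rogawski, *Automorphic Representations of Unitary Groups in Three Variables*, Ann. of Math. Stud. 123 (1990), §4.9 Prop. 4.9.1 (b) p. 55.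
* [Laumon1995] G. Laumon, *Cohomology of Drinfeld Modular Varieties I* (1996), Lemma (5.3.2) p. 136 (the fixed-coset formula).
* [Serre1980Trees] J.-P. Serre, *Trees* (1980), Ch. II §1.1 (lattices, stabilisers, stars).
-/

noncomputable section

namespace Summit.HodgeConjecture.HodgeConjecture.Cruxes.H413.F0P3cDyRamPieceCountDictionaryEdge

open MeasureTheory Measure NumberField IsDedekindDomain Topology Filter Literature.NumberTheory.Automorphic Literature.NumberTheory.Automorphic.UnitaryGroup
open Literature.NumberTheory.Automorphic.IntegralReduction Literature.NumberTheory.Automorphic.UnitaryLatticeTree Literature.NumberTheory.Automorphic.HermitianLattice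
open Literature.NumberTheory.Automorphic.CartanUnique Literature.NumberTheory.Rogawski1990 Literature.NumberTheory.GaloisRepresentations Literature.NumberTheory.Automorphic.UnitaryThreeFourFrame
open Summit.HodgeConjecture.HodgeConjecture.Cruxes.H413.F0P3cDyRamFourFramePieces Summit.HodgeConjecture.HodgeConjecture.Cruxes.H413.F0P3cDyRamFourFrameCensusDefs
open Summit.HodgeConjecture.HodgeConjecture.Cruxes.H413.F0P3cDyRamProfilePiecesProps Summit.HodgeConjecture.HodgeConjecture.Cruxes.H413.F0P3cDyRamAnchorCountDictionaryZero
open Summit.HodgeConjecture.HodgeConjecture.Cruxes.H413.F0P3cDyRamWildPlaceDatum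
open scoped Valued WithZero Matrix MatrixGroups Classical

/-! ## §1  Lattice side: transport, `Ad K`-invariance and `K(ϖ)`-invariance of `edgeFixCount` -/

section Lattice
variable {K : Type*} [Field K] [Valued K ℤᵐ⁰] {σ : K →+* K} {ϖ : K}

/-- `latt 1 = 𝒪^N` (the root). [cite: Serre1980Trees, Ch. II §1.1] -/
theorem latt_one_eq_stdLattice (N : ℕ) : latt (1 : Matrix (Fin N) (Fin N) K) = stdLattice K N :=
  map_toLin'_one _

/-- **TRANSPORT OF THE ROOT'S FIXED STAR**: for `x ∈ U(Φ₃)` and any `T`, `edgeFixCount σ ϖ (x⁻¹ T x) = #{N : type 2, N ≤ x·𝒪³, T·N = N}` (`N ↦ x·N`).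
[cite: Kottwitz1986BaseChangeUnits, §3] [cite: Serre1980Trees, Ch. II §1.1] -/
theorem edgeFixCount_conj_eq_ncard {x : GL (Fin 3) K} (hx : x ∈ unitaryGroupOfForm σ ((StdForm.antidiagonal 3).over K)) (T : GL (Fin 3) K) :
    edgeFixCount σ ϖ (x⁻¹ * T * x) =
      {N : Submodule 𝒪[K] (Fin 3 → K) | IsVertexLattice σ ϖ ((StdForm.antidiagonal 3).over K) 2 N ∧ N ≤ mapGL x (stdLattice K 3) ∧ mapGL T N = N}.ncard := by
  unfold edgeFixCount
  rw [latt_one_eq_stdLattice, ← Set.ncard_image_of_injective _ (mapGL_injective x)]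
  congr 1
  ext N'
  simp only [Set.mem_image, Set.mem_setOf_eq]
  constructor
  · rintro ⟨N, ⟨h2, hle, hfix⟩, rfl⟩
    refine ⟨isVertexLattice_mapGL σ ϖ _ x hx h2, (mapGL_le_mapGL_iff x _ _).2 hle, ?_⟩
    have h := congrArg (mapGL x) hfix
    rwa [mapGL_mul, mapGL_mul, mapGL_mapGL_inv] at h
  · rintro ⟨h2, hle, hfix⟩
    have hx' : x⁻¹ ∈ unitaryGroupOfForm σ ((StdForm.antidiagonal 3).over K) := inv_mem hx
    refine ⟨mapGL x⁻¹ N', ⟨isVertexLattice_mapGL σ ϖ _ x⁻¹ hx' h2, ?_, ?_⟩, mapGL_mapGL_inv x N'⟩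
    · have h := (mapGL_le_mapGL_iff x⁻¹ _ _).2 hle
      rwa [mapGL_inv_mapGL] at h
    · rw [mapGL_mul, mapGL_mul, mapGL_mapGL_inv, hfix]

/-- **`Ad K`-INVARIANCE**: for `k ∈ U(Φ₃)` with `k·𝒪³ = 𝒪³`, `edgeFixCount σ ϖ (k T k⁻¹) = edgeFixCount σ ϖ T`. [cite: Kottwitz1986BaseChangeUnits, §3] -/
theorem edgeFixCount_conj_eq_of_mapGL_stdLattice_eq {k : GL (Fin 3) K} (hk : k ∈ unitaryGroupOfForm σ ((StdForm.antidiagonal 3).over K))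
    (hk0 : mapGL k (stdLattice K 3) = stdLattice K 3) (T : GL (Fin 3) K) :
    edgeFixCount σ ϖ (k * T * k⁻¹) = edgeFixCount σ ϖ T := by
  have hk0' : mapGL k⁻¹ (stdLattice K 3) = stdLattice K 3 := by
    conv_lhs => rw [← hk0]
    exact mapGL_inv_mapGL k _
  have h := edgeFixCount_conj_eq_ncard (σ := σ) (ϖ := ϖ) (inv_mem hk) T
  rw [inv_inv, hk0'] at h
  rw [h]
  unfold edgeFixCount
  rw [latt_one_eq_stdLattice]

/-- **`K(ϖ)`-INVARIANCE AT A WILD RAMIFIED DATUM**: for `U, T ∈ K₀` with `U ≡ 1 (mod ϖ)`, `edgeFixCount σ ϖ (U T) = edgeFixCount σ ϖ T` — every type-2 `N ≤ 𝒪³` is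
`κ·N₁` (★ wild root star) and `U` fixes `κ·N₁`. [cite: Kottwitz1986BaseChangeUnits, §3] [cite: Serre1980Trees, Ch. II §1.1] -/
theorem edgeFixCount_mul_eq_of_congr_one [Finite 𝓀[K]] (hσ : ∀ x, σ (σ x) = x) (hvσ : ∀ a, Valued.v (σ a) = Valued.v a)
    (hϖ : Valued.v ϖ = WithZero.exp (-1 : ℤ)) (heven : ∀ x : K, σ x = x → x ≠ 0 → ∃ n : ℤ, Valued.v x = WithZero.exp (2 * n)) {d t : ℕ}
    (hd : Valued.v (ϖ - σ ϖ) = Valued.v ϖ ^ d) (h1d : 1 ≤ d) (h2t : Valued.v (2 : K) = Valued.v ϖ ^ t)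
    {U T : ↥(unitaryGroupOfForm σ ((StdForm.antidiagonal 3).over K))} (hU : U ∈ unitaryInt σ ((StdForm.antidiagonal 3).over K))
    (hT : T ∈ unitaryInt σ ((StdForm.antidiagonal 3).over K)) (hU1 : ∀ i j, Valued.v ((((U : GL (Fin 3) K) : Matrix (Fin 3) (Fin 3) K) - 1) i j) < 1) :
    edgeFixCount σ ϖ ((U : GL (Fin 3) K) * (T : GL (Fin 3) K)) = edgeFixCount σ ϖ (T : GL (Fin 3) K) := by
  have key : ∀ N : Submodule 𝒪[K] (Fin 3 → K), IsVertexLattice σ ϖ ((StdForm.antidiagonal 3).over K) 2 N → N ≤ stdLattice K 3 →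
      mapGL (U : GL (Fin 3) K) (mapGL (T : GL (Fin 3) K) N) = mapGL (T : GL (Fin 3) K) N := by
    intro N h2 hle
    have h2' : IsVertexLattice σ ϖ ((StdForm.antidiagonal 3).over K) 2 (mapGL (T : GL (Fin 3) K) N) := isVertexLattice_mapGL σ ϖ _ _ T.2 h2
    have hle' : mapGL (T : GL (Fin 3) K) N ≤ stdLattice K 3 := by
      have h := (mapGL_le_mapGL_iff (T : GL (Fin 3) K) _ _).2 hle
      rwa [mapGL_stdLattice_of_mem_unitaryInt hT] at h
    have hlt : mapGL (T : GL (Fin 3) K) N < stdLattice K 3 :=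
      lt_of_le_of_ne hle' fun h => not_isSelfDualLattice_of_isVertexLattice_two_of_v hvσ hϖ h2' (h ▸ isSelfDualLattice_stdLattice_three_of_v hϖ)
    obtain ⟨κ, hκ, hκeq⟩ := (mem_neighborSet_root_iff_exists_mem_unitaryInt_of_even hσ hvσ hϖ heven hd h1d h2t
      ⟨mapGL (T : GL (Fin 3) K) N, 2, h2'⟩).1 ((mem_neighborSet_root_iff_of_v hvσ hϖ _).2 hlt)
    change mapGL (T : GL (Fin 3) K) N = _ at hκeq
    rw [hκeq]
    exact mapGL_mul_N₁_eq_of_congr_one hvσ hϖ hU hκ hU1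
  unfold edgeFixCount
  rw [latt_one_eq_stdLattice]
  congr 1
  ext N
  simp only [Set.mem_setOf_eq]
  refine ⟨fun ⟨h2, hle, hfix⟩ => ⟨h2, hle, ?_⟩, fun ⟨h2, hle, hfix⟩ => ⟨h2, hle, ?_⟩⟩
  · rwa [mapGL_mul, key N h2 hle] at hfix
  · rw [mapGL_mul, key N h2 hle, hfix]
end Lattice

/-! ## §2  The fibre count: summing the fixed type-2 lattices below the fixed type-0 vertices gives the fixed-flag count -/

section Fibre
variable {K : Type*} [Field K] [Valued K ℤᵐ⁰] {σ : K →+* K} {ϖ : K}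

/-- **`Σ_{M type 0, T·M = M} #{N : type 2, N ≤ M, T·N = N} = fixedEdgeCount σ ϖ T`** (finitely many fixed type-0 vertices, finite stars: a disjoint union of fibres).
[cite: Kottwitz1986BaseChangeUnits, §3] [cite: Serre1980Trees, Ch. II §1.1] -/
theorem finsum_ncard_fibre_eq_fixedEdgeCount (T : GL (Fin 3) K)
    (hfin : {M : {M : Submodule 𝒪[K] (Fin 3 → K) // IsVertexLattice σ ϖ ((StdForm.antidiagonal 3).over K) 0 M} | mapGL T M.1 = M.1}.Finite)
    (hfib : ∀ M : Submodule 𝒪[K] (Fin 3 → K), IsVertexLattice σ ϖ ((StdForm.antidiagonal 3).over K) 0 M →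
      {N : Submodule 𝒪[K] (Fin 3 → K) | IsVertexLattice σ ϖ ((StdForm.antidiagonal 3).over K) 2 N ∧ N ≤ M}.Finite) :
    ∑ᶠ M ∈ {M : {M : Submodule 𝒪[K] (Fin 3 → K) // IsVertexLattice σ ϖ ((StdForm.antidiagonal 3).over K) 0 M} | mapGL T M.1 = M.1},
        (({N : Submodule 𝒪[K] (Fin 3 → K) | IsVertexLattice σ ϖ ((StdForm.antidiagonal 3).over K) 2 N ∧ N ≤ M.1 ∧ mapGL T N = N}.ncard : ℕ) : ℂ) =
      (fixedEdgeCount σ ϖ T : ℂ) := by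
  rw [← Nat.cast_finsum_mem hfin, Nat.cast_inj]
  set A := {M : {M : Submodule 𝒪[K] (Fin 3 → K) // IsVertexLattice σ ϖ ((StdForm.antidiagonal 3).over K) 0 M} | mapGL T M.1 = M.1} with hA
  set F : {M : Submodule 𝒪[K] (Fin 3 → K) // IsVertexLattice σ ϖ ((StdForm.antidiagonal 3).over K) 0 M} → Set (Submodule 𝒪[K] (Fin 3 → K)) :=
    fun M => {N : Submodule 𝒪[K] (Fin 3 → K) | IsVertexLattice σ ϖ ((StdForm.antidiagonal 3).over K) 2 N ∧ N ≤ M.1 ∧ mapGL T N = N} with hF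
  let s : {M : Submodule 𝒪[K] (Fin 3 → K) // IsVertexLattice σ ϖ ((StdForm.antidiagonal 3).over K) 0 M} →
      Set (Submodule 𝒪[K] (Fin 3 → K) × Submodule 𝒪[K] (Fin 3 → K)) := fun M => Prod.mk M.1 '' F M
  have hFfin : ∀ M ∈ A, (F M).Finite := fun M _ => (hfib M.1 M.2).subset fun N hN => ⟨hN.1, hN.2.1⟩
  have hs : ∀ M ∈ A, (s M).Finite := fun M hM => (hFfin M hM).image _
  have hdisj : A.PairwiseDisjoint s := by
    intro M _ M' _ hne
    refine Set.disjoint_left.2 fun p hp hp' => hne ?_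
    obtain ⟨N, -, rfl⟩ := hp
    obtain ⟨N', -, hNN'⟩ := hp'
    exact Subtype.ext (Prod.mk.inj hNN').1.symm
  have hU : (⋃ M ∈ A, s M) = {p : Submodule 𝒪[K] (Fin 3 → K) × Submodule 𝒪[K] (Fin 3 → K) |
      IsVertexLattice σ ϖ ((StdForm.antidiagonal 3).over K) 0 p.1 ∧ IsVertexLattice σ ϖ ((StdForm.antidiagonal 3).over K) 2 p.2 ∧ p.2 ≤ p.1 ∧
        mapGL T p.1 = p.1 ∧ mapGL T p.2 = p.2} := by
    ext p
    simp only [Set.mem_iUnion, Set.mem_image, Set.mem_setOf_eq, exists_prop, s, hF, hA]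
    constructor
    · rintro ⟨M, hM, N, ⟨h2, hle, hN⟩, rfl⟩
      exact ⟨M.2, h2, hle, hM, hN⟩
    · rintro ⟨h0, h2, hle, hM, hN⟩
      exact ⟨⟨p.1, h0⟩, hM, p.2, ⟨h2, hle, hN⟩, rfl⟩
  calc ∑ᶠ M ∈ A, (F M).ncard = ∑ᶠ M ∈ A, (s M).ncard :=
        finsum_mem_congr rfl fun M _ => (Set.ncard_image_of_injective _ (Prod.mk_right_injective _)).symm
    _ = (⋃ M ∈ A, s M).ncard := (hfin.ncard_biUnion hs hdisj).symm
    _ = fixedEdgeCount σ ϖ T := by rw [hU]; rfl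
end Fibre

/-! ## §3  At the CM place: the edge piece is smooth, `Ad K`-invariant, and carries the fixed-star value law; the dictionary -/

section Place
variable (L : Type) [Field L] [NumberField L] [IsCMField L] {v : HeightOneSpectrum (𝓞 ↥(maximalRealSubfield L))}
  (w : PlacesOver L v) (hw : IsCMField.complexConj L • w.1 = w.1)

include hw in
/-- **THE EDGE PIECE IS LOCALLY SMOOTH WITH `tsupport ⊆ K`** (at a ramified non-split place): it is LEFT-INVARIANT under «`ι_w(U) ≡ 1 (mod ϖ)`» (§1 `K(ϖ)`-invariance at the
wild datum of the place, ★ `exists_isRamifiedQuadraticDatum_of_placesOver`) and `K`-supported (★ `isLocSmooth_of_level_invariant_of_support_subset`).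
[cite: Kottwitz1986BaseChangeUnits, §3] [cite: Rogawski1990, §4.9 Prop. 4.9.1 (b) p. 55] -/
theorem isLocSmooth_pieceEdge (he : v.asIdeal.ramificationIdx' w.1.asIdeal ≠ 1) {ϖ : w.1.adicCompletion L} (hϖ : Valued.v ϖ = WithZero.exp (-1 : ℤ)) :
    IsLocSmooth (pieceEdge L v w hw ϖ) ∧
      tsupport (pieceEdge L v w hw ϖ) ⊆ (cmLocalIntegralLevel L 3 (Matrix.of fun i j : Fin 3 => if i.val + j.val + 1 = 3 then (1 : L) else 0) v :
        Set ((UnitaryGroup.cmDatum L 3 (Matrix.of fun i j : Fin 3 => if i.val + j.val + 1 = 3 then (1 : L) else 0)).Local v)) := by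
  have hc1 : IsCMField.complexConj L ≠ 1 := IsCMField.complexConj_ne_one L
  obtain ⟨hϖ0, hϖ1, -⟩ := uniformizer_facts L w hϖ
  obtain ⟨d, t, hD⟩ := exists_isRamifiedQuadraticDatum_of_placesOver L w hw he ϖ hϖ
  obtain ⟨hσ, hvσ, -, heven, hd, h1d, h2t⟩ := hD
  refine isLocSmooth_of_level_invariant_of_support_subset L 3 (Matrix.of fun i j : Fin 3 => if i.val + j.val + 1 = 3 then (1 : L) else 0) hc1 w hw hϖ0 1 _
    (fun U hU x => ?_) Set.support_indicator_subset
  have hUK : U ∈ cmLocalIntegralLevel L 3 (Matrix.of fun i j : Fin 3 => if i.val + j.val + 1 = 3 then (1 : L) else 0) v :=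
    mem_cmLocalIntegralLevel_of_level L 3 (Matrix.of fun i j : Fin 3 => if i.val + j.val + 1 = 3 then (1 : L) else 0) hc1 w hw hϖ0 hϖ1 le_rfl U hU
  let ι : ((UnitaryGroup.cmDatum L 3 (Matrix.of fun i j : Fin 3 => if i.val + j.val + 1 = 3 then (1 : L) else 0)).Local v) →* GL (Fin 3) (w.1.adicCompletion L) :=
    (Subgroup.subtype _).comp (localNonsplitEquiv (IsCMField.complexConj L) (Matrix.of fun i j : Fin 3 => if i.val + j.val + 1 = 3 then (1 : L) else 0) hc1 w hw).toMulEquiv.toMonoidHom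
  have hιe : ∀ u, ι u = ((localNonsplitEquiv (IsCMField.complexConj L) (Matrix.of fun i j : Fin 3 => if i.val + j.val + 1 = 3 then (1 : L) else 0) hc1 w hw u :
      ↥(unitaryGroupOfForm (galAdicCompletionMap (L := L) (IsCMField.complexConj L) hw) (placeForm (Matrix.of fun i j : Fin 3 => if i.val + j.val + 1 = 3 then (1 : L) else 0) w.1))) :
        GL (Fin 3) (w.1.adicCompletion L)) := fun _ => rfl
  have hxU : ∀ u, ι u ∈ unitaryGroupOfForm (galAdicCompletionMap (L := L) (IsCMField.complexConj L) hw) ((StdForm.antidiagonal 3).over (w.1.adicCompletion L)) := fun u => by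
    rw [hιe]; exact coe_mem_unitaryGroupOfForm_over L w hw u
  by_cases hx : x ∈ cmLocalIntegralLevel L 3 (Matrix.of fun i j : Fin 3 => if i.val + j.val + 1 = 3 then (1 : L) else 0) v
  · show Set.indicator (cmLocalIntegralLevel L 3 (Matrix.of fun i j : Fin 3 => if i.val + j.val + 1 = 3 then (1 : L) else 0) v :
        Set ((UnitaryGroup.cmDatum L 3 (Matrix.of fun i j : Fin 3 => if i.val + j.val + 1 = 3 then (1 : L) else 0)).Local v))
        (fun u => (edgeFixCount (galAdicCompletionMap (L := L) (IsCMField.complexConj L) hw) ϖ (ι u) : ℂ)) (U * x) =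
      Set.indicator (cmLocalIntegralLevel L 3 (Matrix.of fun i j : Fin 3 => if i.val + j.val + 1 = 3 then (1 : L) else 0) v :
        Set ((UnitaryGroup.cmDatum L 3 (Matrix.of fun i j : Fin 3 => if i.val + j.val + 1 = 3 then (1 : L) else 0)).Local v))
        (fun u => (edgeFixCount (galAdicCompletionMap (L := L) (IsCMField.complexConj L) hw) ϖ (ι u) : ℂ)) x
    rw [Set.indicator_of_mem (mul_mem hUK hx), Set.indicator_of_mem hx, map_mul]
    have hU1 : ∀ i j, Valued.v ((((ι U : GL (Fin 3) (w.1.adicCompletion L)) : Matrix (Fin 3) (Fin 3) (w.1.adicCompletion L)) - 1) i j) < 1 := by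
      rw [Literature.NumberTheory.Automorphic.isIntMatrix_inv_smul_iff (pow_ne_zero _ hϖ0)] at hU
      exact fun i j => (hU i j).trans_lt (by rw [pow_one]; exact hϖ1)
    have hUint := (mem_cmLocalIntegralLevel_iff_isIntMatrix L 3 (Matrix.of fun i j : Fin 3 => if i.val + j.val + 1 = 3 then (1 : L) else 0) hc1 w hw U).1 hUK
    have hxint := (mem_cmLocalIntegralLevel_iff_isIntMatrix L 3 (Matrix.of fun i j : Fin 3 => if i.val + j.val + 1 = 3 then (1 : L) else 0) hc1 w hw x).1 hx
    exact congrArg (fun n : ℕ => (n : ℂ)) (edgeFixCount_mul_eq_of_congr_one (ϖ := ϖ) hσ hvσ hϖ heven hd h1d h2t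
      (U := ⟨ι U, hxU U⟩) (T := ⟨ι x, hxU x⟩) (mem_unitaryInt_iff.2 ⟨hUint.1, hUint.2⟩) (mem_unitaryInt_iff.2 ⟨hxint.1, hxint.2⟩) hU1)
  · have hUx : U * x ∉ cmLocalIntegralLevel L 3 (Matrix.of fun i j : Fin 3 => if i.val + j.val + 1 = 3 then (1 : L) else 0) v :=
      fun h => hx ((Subgroup.mul_mem_cancel_left _ hUK).1 h)
    show Set.indicator _ _ (U * x) = Set.indicator _ _ x
    rw [Set.indicator_of_notMem hUx, Set.indicator_of_notMem hx]

include hw in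
/-- **THE EDGE PIECE IS `Ad K`-INVARIANT**: `g_E(k y k⁻¹) = g_E(y)` for `k ∈ K` (§1 transport; `k` fixes `𝒪_w³`). [cite: Kottwitz1986BaseChangeUnits, §3] -/
theorem pieceEdge_conj_eq (ϖ : w.1.adicCompletion L)
    {k : ((UnitaryGroup.cmDatum L 3 (Matrix.of fun i j : Fin 3 => if i.val + j.val + 1 = 3 then (1 : L) else 0)).Local v)}
    (hk : k ∈ cmLocalIntegralLevel L 3 (Matrix.of fun i j : Fin 3 => if i.val + j.val + 1 = 3 then (1 : L) else 0) v)
    (y : ((UnitaryGroup.cmDatum L 3 (Matrix.of fun i j : Fin 3 => if i.val + j.val + 1 = 3 then (1 : L) else 0)).Local v)) :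
    pieceEdge L v w hw ϖ (k * y * k⁻¹) = pieceEdge L v w hw ϖ y := by
  have hc1 : IsCMField.complexConj L ≠ 1 := IsCMField.complexConj_ne_one L
  have hk0 := ((mem_localIntegralLevel_iff_of_smul_eq (IsCMField.complexConj L) 3 (Matrix.of fun i j : Fin 3 => if i.val + j.val + 1 = 3 then (1 : L) else 0) hc1 w hw k).trans
      (mapGL_stdLattice_eq_iff_mem_glInt _).symm).1 hk
  let ι : ((UnitaryGroup.cmDatum L 3 (Matrix.of fun i j : Fin 3 => if i.val + j.val + 1 = 3 then (1 : L) else 0)).Local v) →* GL (Fin 3) (w.1.adicCompletion L) :=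
    (Subgroup.subtype _).comp (localNonsplitEquiv (IsCMField.complexConj L) (Matrix.of fun i j : Fin 3 => if i.val + j.val + 1 = 3 then (1 : L) else 0) hc1 w hw).toMulEquiv.toMonoidHom
  have hιe : ∀ u, ι u = ((localNonsplitEquiv (IsCMField.complexConj L) (Matrix.of fun i j : Fin 3 => if i.val + j.val + 1 = 3 then (1 : L) else 0) hc1 w hw u :
      ↥(unitaryGroupOfForm (galAdicCompletionMap (L := L) (IsCMField.complexConj L) hw) (placeForm (Matrix.of fun i j : Fin 3 => if i.val + j.val + 1 = 3 then (1 : L) else 0) w.1))) :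
        GL (Fin 3) (w.1.adicCompletion L)) := fun _ => rfl
  have hkU : ι k ∈ unitaryGroupOfForm (galAdicCompletionMap (L := L) (IsCMField.complexConj L) hw) ((StdForm.antidiagonal 3).over (w.1.adicCompletion L)) := by
    rw [hιe]; exact coe_mem_unitaryGroupOfForm_over L w hw k
  have hk0' : mapGL (ι k) (stdLattice (w.1.adicCompletion L) 3) = stdLattice (w.1.adicCompletion L) 3 := by rw [hιe]; exact hk0
  by_cases hy : y ∈ cmLocalIntegralLevel L 3 (Matrix.of fun i j : Fin 3 => if i.val + j.val + 1 = 3 then (1 : L) else 0) v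
  · have hky : k * y * k⁻¹ ∈ cmLocalIntegralLevel L 3 (Matrix.of fun i j : Fin 3 => if i.val + j.val + 1 = 3 then (1 : L) else 0) v :=
      mul_mem (mul_mem hk hy) (inv_mem hk)
    show Set.indicator (cmLocalIntegralLevel L 3 (Matrix.of fun i j : Fin 3 => if i.val + j.val + 1 = 3 then (1 : L) else 0) v :
        Set ((UnitaryGroup.cmDatum L 3 (Matrix.of fun i j : Fin 3 => if i.val + j.val + 1 = 3 then (1 : L) else 0)).Local v))
        (fun u => (edgeFixCount (galAdicCompletionMap (L := L) (IsCMField.complexConj L) hw) ϖ (ι u) : ℂ)) (k * y * k⁻¹) =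
      Set.indicator (cmLocalIntegralLevel L 3 (Matrix.of fun i j : Fin 3 => if i.val + j.val + 1 = 3 then (1 : L) else 0) v :
        Set ((UnitaryGroup.cmDatum L 3 (Matrix.of fun i j : Fin 3 => if i.val + j.val + 1 = 3 then (1 : L) else 0)).Local v))
        (fun u => (edgeFixCount (galAdicCompletionMap (L := L) (IsCMField.complexConj L) hw) ϖ (ι u) : ℂ)) y
    rw [Set.indicator_of_mem hky, Set.indicator_of_mem hy, map_mul, map_mul, map_inv]
    exact congrArg (fun n : ℕ => (n : ℂ)) (edgeFixCount_conj_eq_of_mapGL_stdLattice_eq hkU hk0' _)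
  · have hky : k * y * k⁻¹ ∉ cmLocalIntegralLevel L 3 (Matrix.of fun i j : Fin 3 => if i.val + j.val + 1 = 3 then (1 : L) else 0) v := fun h => hy (by
      have h' := mul_mem (mul_mem (inv_mem hk) h) hk
      rwa [show k⁻¹ * (k * y * k⁻¹) * k = y by group] at h')
    show Set.indicator _ _ (k * y * k⁻¹) = Set.indicator _ _ y
    rw [Set.indicator_of_notMem hky, Set.indicator_of_notMem hy]
end Place

/-! ## §4  The head: `PieceCountDictionary pieceEdge cntEdge` -/

section Head
set_option maxHeartbeats 400000 in  -- cumulative elaboration of the 37-binder dictionary statement + the vertex-action bookkeeping; no single heavy `isDefEq`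
/-- **THE CENSUS DICTIONARY OF THE EDGE PIECE** (pays `U2GCensus.stub_U2G_dict_edge` BY NAME): at every wild ramified non-split place, for the canonical family `mG₃` and
every type-(1) literal `γ` (`ι_w γ = z·Γ_b`), `Φ(⟦γ⟧, g_E; mG₃) = νG₃(K).toReal · fixedEdgeCount σ_w ϖ (ι_w γ)` — the orbital integral of the edge piece counts the FIXED
FLAGS (type-0 vertex over type-2 vertex) of `ι_w γ`: ★ `classOrbitalIntegral_eq_smul_finsum_fixedPoints_of_vertexAction` on the type-0 vertices (`K = Stab(𝒪_w³)`, vertex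
transitivity ★ p854598, value law §1) + the fibre count §2.  (The (K-1)(c) relation `e = n₀ + n₂ − 1` is U3's edge LAW, not used here.)
[cite: Kottwitz1986BaseChangeUnits, §3] [cite: Rogawski1990, §4.9 Prop. 4.9.1 (b) p. 55] [cite: Laumon1995, Lemma (5.3.2) p. 136] -/
theorem pieceCountDictionary_edge : PieceCountDictionary pieceEdge cntEdge := by
  intro L _ _ _ v w hw he _h2 ϖ hϖ _ _ _ _ νG₃ _ _ mG₃ hcan f hf α β z hα hβ hz hαβ hα1 hβ1 b Γ hΓ γ hγ
  have hc1 : IsCMField.complexConj L ≠ 1 := IsCMField.complexConj_ne_one L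
  have hpf : placeForm (Matrix.of fun i j : Fin 3 => if i.val + j.val + 1 = 3 then (1 : L) else 0) w.1 = (StdForm.antidiagonal 3).over (w.1.adicCompletion L) :=
    placeForm_antidiagThree_eq_over L w
  have hH : (((Matrix.of fun i j : Fin 3 => if i.val + j.val + 1 = 3 then (1 : L) else 0)).map (cmConjRingHom L))ᵀ =
      (Matrix.of fun i j : Fin 3 => if i.val + j.val + 1 = 3 then (1 : L) else 0) := antidiagOne_isHermitian L 3
  have hdet : ((Matrix.of fun i j : Fin 3 => if i.val + j.val + 1 = 3 then (1 : L) else 0)).det ≠ 0 := (isUnit_antidiagOne_det L 3).ne_zero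
  obtain ⟨d, t, hD⟩ := exists_isRamifiedQuadraticDatum_of_placesOver L w hw he ϖ hϖ
  have hvσ : ∀ a : w.1.adicCompletion L, Valued.v (galAdicCompletionMap (L := L) (IsCMField.complexConj L) hw a) = Valued.v a := hD.2.1
  obtain ⟨Q, uu, hQ, hu, hu1⟩ := exists_eigenframe_localRing_of_coe_eq_smul_frameElt L w hw γ hf hα hβ hz hαβ hα1 hβ1 b hΓ hγ
  have hreg : IsRegularElt (γ.val : GL (Fin 3) (UnitaryGroup.LocalRing L v)) :=
    isRegularElt_of_eigenframe L (Matrix.of fun i j : Fin 3 => if i.val + j.val + 1 = 3 then (1 : L) else 0) w hw γ hQ hu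
  haveI : CompactSpace (Subgroup.centralizer ({γ} : Set ((UnitaryGroup.cmDatum L 3 (Matrix.of fun i j : Fin 3 => if i.val + j.val + 1 = 3 then (1 : L) else 0)).Local v))) :=
    compactSpace_centralizer_of_eigenframe_of_smul_eq L w hw (Matrix.of fun i j : Fin 3 => if i.val + j.val + 1 = 3 then (1 : L) else 0) hH hdet γ hQ hu hu1
  obtain ⟨hKc, hKo⟩ := isCompact_isOpen_cmLocalIntegralLevel L 3 (Matrix.of fun i j : Fin 3 => if i.val + j.val + 1 = 3 then (1 : L) else 0) v
  have hO := isClosed_conjClass_local_of_isRegularElt L 3 (Matrix.of fun i j : Fin 3 => if i.val + j.val + 1 = 3 then (1 : L) else 0) v hH hdet γ hreg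
  obtain ⟨ι, hιe⟩ : ∃ ι : ((UnitaryGroup.cmDatum L 3 (Matrix.of fun i j : Fin 3 => if i.val + j.val + 1 = 3 then (1 : L) else 0)).Local v) →* GL (Fin 3) (w.1.adicCompletion L),
      ∀ u, ι u = ((localNonsplitEquiv (IsCMField.complexConj L) (Matrix.of fun i j : Fin 3 => if i.val + j.val + 1 = 3 then (1 : L) else 0) (IsCMField.complexConj_ne_one L) w hw u :
        ↥(unitaryGroupOfForm (galAdicCompletionMap (L := L) (IsCMField.complexConj L) hw) (placeForm (Matrix.of fun i j : Fin 3 => if i.val + j.val + 1 = 3 then (1 : L) else 0) w.1))) :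
          GL (Fin 3) (w.1.adicCompletion L)) :=
    ⟨(Subgroup.subtype _).comp (localNonsplitEquiv (IsCMField.complexConj L) (Matrix.of fun i j : Fin 3 => if i.val + j.val + 1 = 3 then (1 : L) else 0) hc1 w hw).toMulEquiv.toMonoidHom,
      fun _ => rfl⟩
  have hpE : pieceEdge L v w hw ϖ = Set.indicator (cmLocalIntegralLevel L 3 (Matrix.of fun i j : Fin 3 => if i.val + j.val + 1 = 3 then (1 : L) else 0) v :
        Set ((UnitaryGroup.cmDatum L 3 (Matrix.of fun i j : Fin 3 => if i.val + j.val + 1 = 3 then (1 : L) else 0)).Local v))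
      (fun u => (edgeFixCount (galAdicCompletionMap (L := L) (IsCMField.complexConj L) hw) ϖ (ι u) : ℂ)) := by
    funext u
    simp only [pieceEdge, hιe]
  have hN : IsVertexLattice (galAdicCompletionMap (L := L) (IsCMField.complexConj L) hw) ϖ ((StdForm.antidiagonal 3).over (w.1.adicCompletion L)) 0 (stdLattice (w.1.adicCompletion L) 3) :=
    isSelfDualLattice_stdLattice_three_of_v hϖ
  have hKt : ∀ u : ((UnitaryGroup.cmDatum L 3 (Matrix.of fun i j : Fin 3 => if i.val + j.val + 1 = 3 then (1 : L) else 0)).Local v),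
      u ∈ cmLocalIntegralLevel L 3 (Matrix.of fun i j : Fin 3 => if i.val + j.val + 1 = 3 then (1 : L) else 0) v ↔
        mapGL (ι u) (stdLattice (w.1.adicCompletion L) 3) = stdLattice (w.1.adicCompletion L) 3 := fun u => by
    rw [hιe]
    exact (mem_localIntegralLevel_iff_of_smul_eq (IsCMField.complexConj L) 3 (Matrix.of fun i j : Fin 3 => if i.val + j.val + 1 = 3 then (1 : L) else 0) hc1 w hw u).trans
      (mapGL_stdLattice_eq_iff_mem_glInt _).symm
  have hxU : ∀ u : ((UnitaryGroup.cmDatum L 3 (Matrix.of fun i j : Fin 3 => if i.val + j.val + 1 = 3 then (1 : L) else 0)).Local v),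
      ι u ∈ unitaryGroupOfForm (galAdicCompletionMap (L := L) (IsCMField.complexConj L) hw) ((StdForm.antidiagonal 3).over (w.1.adicCompletion L)) := fun u => by
    rw [hιe]; exact coe_mem_unitaryGroupOfForm_over L w hw u
  have htr : ∀ M : Submodule 𝒪[w.1.adicCompletion L] (Fin 3 → w.1.adicCompletion L),
      IsVertexLattice (galAdicCompletionMap (L := L) (IsCMField.complexConj L) hw) ϖ ((StdForm.antidiagonal 3).over (w.1.adicCompletion L)) 0 M →
        ∃ u : ((UnitaryGroup.cmDatum L 3 (Matrix.of fun i j : Fin 3 => if i.val + j.val + 1 = 3 then (1 : L) else 0)).Local v), mapGL (ι u) (stdLattice (w.1.adicCompletion L) 3) = M := by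
    intro M hM
    obtain ⟨u₁, hu₁⟩ := exists_unitary_mapGL_eq_of_isSelfDualLattice_ramifiedCM L v w hw he hϖ hN hM
    have hu₁' : (u₁ : GL (Fin 3) (w.1.adicCompletion L)) ∈ unitaryGroupOfForm (galAdicCompletionMap (L := L) (IsCMField.complexConj L) hw)
        (placeForm (Matrix.of fun i j : Fin 3 => if i.val + j.val + 1 = 3 then (1 : L) else 0) w.1) := by
      rw [hpf]; exact u₁.2
    refine ⟨(localNonsplitEquiv (IsCMField.complexConj L) (Matrix.of fun i j : Fin 3 => if i.val + j.val + 1 = 3 then (1 : L) else 0) hc1 w hw).symm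
      ⟨(u₁ : GL (Fin 3) (w.1.adicCompletion L)), hu₁'⟩, ?_⟩
    rw [hιe, ContinuousMulEquiv.apply_symm_apply]
    exact hu₁
  obtain ⟨act, hact⟩ : ∃ act : ((UnitaryGroup.cmDatum L 3 (Matrix.of fun i j : Fin 3 => if i.val + j.val + 1 = 3 then (1 : L) else 0)).Local v) →
      {M : Submodule 𝒪[w.1.adicCompletion L] (Fin 3 → w.1.adicCompletion L) //
        IsVertexLattice (galAdicCompletionMap (L := L) (IsCMField.complexConj L) hw) ϖ ((StdForm.antidiagonal 3).over (w.1.adicCompletion L)) 0 M} →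
      {M : Submodule 𝒪[w.1.adicCompletion L] (Fin 3 → w.1.adicCompletion L) //
        IsVertexLattice (galAdicCompletionMap (L := L) (IsCMField.complexConj L) hw) ϖ ((StdForm.antidiagonal 3).over (w.1.adicCompletion L)) 0 M},
      ∀ u M, (act u M).1 = mapGL (ι u) M.1 :=
    ⟨fun u M => ⟨mapGL (ι u) M.1, isVertexLattice_mapGL (galAdicCompletionMap (L := L) (IsCMField.complexConj L) hw) ϖ _ (ι u) (hxU u) M.2⟩, fun _ _ => rfl⟩
  have act_one : ∀ M, act 1 M = M := fun M => Subtype.ext (by rw [hact, map_one, mapGL_one])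
  have act_mul : ∀ g h M, act (g * h) M = act g (act h M) := fun g h M => Subtype.ext (by rw [hact, hact, hact, map_mul, mapGL_mul])
  have hV : ∀ M : {M : Submodule 𝒪[w.1.adicCompletion L] (Fin 3 → w.1.adicCompletion L) //
      IsVertexLattice (galAdicCompletionMap (L := L) (IsCMField.complexConj L) hw) ϖ ((StdForm.antidiagonal 3).over (w.1.adicCompletion L)) 0 M},
      ∃ g, act g ⟨stdLattice (w.1.adicCompletion L) 3, hN⟩ = M := fun M => by
    obtain ⟨u, hu⟩ := htr M.1 M.2
    exact ⟨u, Subtype.ext (by rw [hact]; exact hu)⟩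
  have hKv : ∀ g, g ∈ cmLocalIntegralLevel L 3 (Matrix.of fun i j : Fin 3 => if i.val + j.val + 1 = 3 then (1 : L) else 0) v ↔
      act g ⟨stdLattice (w.1.adicCompletion L) 3, hN⟩ = ⟨stdLattice (w.1.adicCompletion L) 3, hN⟩ := fun g => by
    rw [hKt, Subtype.ext_iff, hact]
  obtain ⟨hsm, -⟩ := isLocSmooth_pieceEdge L w hw he hϖ
  have hsupp : Function.support (pieceEdge L v w hw ϖ) ⊆
      (cmLocalIntegralLevel L 3 (Matrix.of fun i j : Fin 3 => if i.val + j.val + 1 = 3 then (1 : L) else 0) v :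
        Set ((UnitaryGroup.cmDatum L 3 (Matrix.of fun i j : Fin 3 => if i.val + j.val + 1 = 3 then (1 : L) else 0)).Local v)) := by
    rw [hpE]; exact Set.support_indicator_subset
  have hval : ∀ g : ((UnitaryGroup.cmDatum L 3 (Matrix.of fun i j : Fin 3 => if i.val + j.val + 1 = 3 then (1 : L) else 0)).Local v),
      act γ (act g ⟨stdLattice (w.1.adicCompletion L) 3, hN⟩) = act g ⟨stdLattice (w.1.adicCompletion L) 3, hN⟩ →
        pieceEdge L v w hw ϖ (g⁻¹ * γ * g) =
          (fun M : {M : Submodule 𝒪[w.1.adicCompletion L] (Fin 3 → w.1.adicCompletion L) //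
              IsVertexLattice (galAdicCompletionMap (L := L) (IsCMField.complexConj L) hw) ϖ ((StdForm.antidiagonal 3).over (w.1.adicCompletion L)) 0 M} =>
            (({N : Submodule 𝒪[w.1.adicCompletion L] (Fin 3 → w.1.adicCompletion L) |
              IsVertexLattice (galAdicCompletionMap (L := L) (IsCMField.complexConj L) hw) ϖ ((StdForm.antidiagonal 3).over (w.1.adicCompletion L)) 2 N ∧
                N ≤ M.1 ∧ mapGL (ι γ) N = N}.ncard : ℕ) : ℂ)) (act g ⟨stdLattice (w.1.adicCompletion L) 3, hN⟩) := by
    intro g hfix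
    have hfix' : mapGL (ι γ) (mapGL (ι g) (stdLattice (w.1.adicCompletion L) 3)) = mapGL (ι g) (stdLattice (w.1.adicCompletion L) 3) := by
      have h := congrArg Subtype.val hfix
      rwa [hact, hact] at h
    have hmemK : g⁻¹ * γ * g ∈ cmLocalIntegralLevel L 3 (Matrix.of fun i j : Fin 3 => if i.val + j.val + 1 = 3 then (1 : L) else 0) v := by
      rw [hKt, map_mul, map_mul, map_inv, mapGL_mul, mapGL_mul, hfix', mapGL_inv_mapGL]
    have hιconj : ι (g⁻¹ * γ * g) = (ι g)⁻¹ * ι γ * ι g := by rw [map_mul, map_mul, map_inv]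
    rw [hpE, Set.indicator_of_mem hmemK]
    show (edgeFixCount (galAdicCompletionMap (L := L) (IsCMField.complexConj L) hw) ϖ (ι (g⁻¹ * γ * g)) : ℂ) =
      (({N : Submodule 𝒪[w.1.adicCompletion L] (Fin 3 → w.1.adicCompletion L) |
        IsVertexLattice (galAdicCompletionMap (L := L) (IsCMField.complexConj L) hw) ϖ ((StdForm.antidiagonal 3).over (w.1.adicCompletion L)) 2 N ∧
          N ≤ (act g ⟨stdLattice (w.1.adicCompletion L) 3, hN⟩).1 ∧ mapGL (ι γ) N = N}.ncard : ℕ) : ℂ)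
    rw [hιconj, edgeFixCount_conj_eq_ncard (ϖ := ϖ) (hxU g) (ι γ), hact]
  have hb := classOrbitalIntegral_eq_smul_finsum_fixedPoints_of_vertexAction act act_one act_mul
    (P := fun γ : ((UnitaryGroup.cmDatum L 3 (Matrix.of fun i j : Fin 3 => if i.val + j.val + 1 = 3 then (1 : L) else 0)).Local v) =>
      IsRegularElt (γ.val : GL (Fin 3) (UnitaryGroup.LocalRing L v)))
    (fun g' x hg' => isRegularElt_val_conj L 3 (Matrix.of fun i j : Fin 3 => if i.val + j.val + 1 = 3 then (1 : L) else 0) v g' x hg') hcan hreg hV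
    (cmLocalIntegralLevel L 3 (Matrix.of fun i j : Fin 3 => if i.val + j.val + 1 = 3 then (1 : L) else 0) v) hKv hKo hKc hO (pieceEdge L v w hw ϖ)
    hsm.continuous hsupp (fun k hk y => pieceEdge_conj_eq L w hw ϖ hk y)
    (fun M : {M : Submodule 𝒪[w.1.adicCompletion L] (Fin 3 → w.1.adicCompletion L) //
        IsVertexLattice (galAdicCompletionMap (L := L) (IsCMField.complexConj L) hw) ϖ ((StdForm.antidiagonal 3).over (w.1.adicCompletion L)) 0 M} =>
      (({N : Submodule 𝒪[w.1.adicCompletion L] (Fin 3 → w.1.adicCompletion L) |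
        IsVertexLattice (galAdicCompletionMap (L := L) (IsCMField.complexConj L) hw) ϖ ((StdForm.antidiagonal 3).over (w.1.adicCompletion L)) 2 N ∧
          N ≤ M.1 ∧ mapGL (ι γ) N = N}.ncard : ℕ) : ℂ)) hval
  have hset : {M : {M : Submodule 𝒪[w.1.adicCompletion L] (Fin 3 → w.1.adicCompletion L) //
      IsVertexLattice (galAdicCompletionMap (L := L) (IsCMField.complexConj L) hw) ϖ ((StdForm.antidiagonal 3).over (w.1.adicCompletion L)) 0 M} |
        act γ M = M} =
      {M | mapGL (ι γ) M.1 = M.1} := Set.ext fun M => by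
    rw [Set.mem_setOf_eq, Set.mem_setOf_eq, Subtype.ext_iff, hact]
  have hfin : {M : {M : Submodule 𝒪[w.1.adicCompletion L] (Fin 3 → w.1.adicCompletion L) //
      IsVertexLattice (galAdicCompletionMap (L := L) (IsCMField.complexConj L) hw) ϖ ((StdForm.antidiagonal 3).over (w.1.adicCompletion L)) 0 M} |
        mapGL (ι γ) M.1 = M.1}.Finite := by
    rw [← hset]
    exact (Literature.GroupTheory.finite_fixedBy_quotient_iff_of_vertexAction act act_one act_mul hV _ hKv γ).1
      (finite_fixedBy_quotient_of_isClosed γ (cmLocalIntegralLevel L 3 (Matrix.of fun i j : Fin 3 => if i.val + j.val + 1 = 3 then (1 : L) else 0) v) hO hKo hKc)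
  have hfib : ∀ M : Submodule 𝒪[w.1.adicCompletion L] (Fin 3 → w.1.adicCompletion L),
      IsVertexLattice (galAdicCompletionMap (L := L) (IsCMField.complexConj L) hw) ϖ ((StdForm.antidiagonal 3).over (w.1.adicCompletion L)) 0 M →
        {N : Submodule 𝒪[w.1.adicCompletion L] (Fin 3 → w.1.adicCompletion L) |
          IsVertexLattice (galAdicCompletionMap (L := L) (IsCMField.complexConj L) hw) ϖ ((StdForm.antidiagonal 3).over (w.1.adicCompletion L)) 2 N ∧ N ≤ M}.Finite := by
    intro M hM
    have hcard := ncard_neighborSet_of_isSelfDualLattice_of_isRamifiedQuadraticDatum _ ϖ d t hD ⟨M, 0, hM⟩ hM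
    have hfinS : ((latticeGraph (galAdicCompletionMap (L := L) (IsCMField.complexConj L) hw) ϖ ((StdForm.antidiagonal 3).over (w.1.adicCompletion L))).neighborSet
        ⟨M, 0, hM⟩).Finite := Set.finite_of_ncard_ne_zero (by rw [hcard]; exact Nat.succ_ne_zero _)
    refine (hfinS.image Subtype.val).subset fun N hN => ?_
    have hne : N ≠ M := fun h => not_isSelfDualLattice_of_isVertexLattice_two_of_v hvσ hϖ hN.1 (h ▸ hM)
    refine ⟨⟨N, 2, hN.1⟩, ?_, rfl⟩
    rw [SimpleGraph.mem_neighborSet, latticeGraph_adj_iff_lt_of_isSelfDualLattice_of_v hvσ hM]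
    exact lt_of_le_of_ne hN.2 hne
  rw [hset, finsum_ncard_fibre_eq_fixedEdgeCount (ι γ) hfin hfib, Measure.real, Complex.real_smul] at hb
  rw [hb, hιe]
  rfl
end Head

end Summit.HodgeConjecture.HodgeConjecture.Cruxes.H413.F0P3cDyRamPieceCountDictionaryEdge

end
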